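import Mathlib
import Summits.ValiantsHypothesis.ValiantsHypothesis.Theorems.GrenetZeonTwoDimCoefficientsDualUnipotentThinNumeratorCalculus
import Summits.ValiantsHypothesis.ValiantsHypothesis.Theorems.GrenetZeonTwoDimCoefficientsDualUnipotentCentredNumeratorPencil
import Summits.ValiantsHypothesis.ValiantsHypothesis.Theorems.GrenetZeonTwoDimCoefficientsDualUnipotentCentredCrossForm
import Summits.ValiantsHypothesis.ValiantsHypothesis.Theorems.GrenetZeonTwoDimCoefficientsDualUnipotentCutAlgebra

/-!
# Crux `GrenetZeon.TwoDimCoefficients` (stmt-ValiantsHypothesis-8062) / rung `DualUnipotentThreeHalves` (stmt-24318):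
# the ONE-CUT HESSIAN-RATE LEMMA — a thin invariant cut forces (H), wild diagonal blocks allowed

Conjecture (H) HessianRate (plan of record for 24318, ✓ `threeHalves_of_hessianRate`) was known in kernel on the LAYERED
family (✓ `finrank_span_layeredHessianImage_le'`, `C = 4`, row-block COORDINATE form, without the identification with
`hess0`).  With the exact formula ✓ `hess0_transl_resolvent_eq_cross_const` (`Hess_p = Ψ + Ψᵀ`,
`Ψ(s,t) = tr(K N_s K N_t K E)`, `K = (1 − N(p))⁻¹`) the mechanism becomes a ONE-CUT statement in the official `hess0`
currency, with NO hypothesis on the two diagonal blocks: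

★★★ `rank_cross_const_le_of_cut` / `rank_hess0_resolvent_const_le_of_cut` — let `N` be an affine `m × m` pencil with
`N^m = 0`, `E` a constant numerator, `D` a constant idempotent (`D² = D`; `U = range D`, `W = ker D`) such that
  (cut)  `(1 − D)·N(x)·D ≡ 0` — the pencil maps `U` into `U` (hypotheses on the linear parts and on the value at `p`),
  (num)  `D·E·D = 0 = (1 − D)·E·(1 − D)` — the numerator has no diagonal blocks.
Then at the point `p`
  `rank Ψ_p ≤ 3·m·rank(D·N(p)·(1 − D)) + 2·rank coeff(D·N·(1 − D))`, hence
  `rank Hess_p Σ_{j<m} tr(N^j·E) ≤ 6·m·rank(D·N(p)·(1 − D)) + 4·rank coeff(D·N·(1 − D))`: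
the Hessian rank is controlled by the CONNECTING BLOCK `U ← W` of the pencil alone (its value at `p` and its linear
parts), whatever the (possibly wild) diagonal blocks `D N D`, `(1−D) N (1−D)` are.  For the layered family cut at its
thinnest level `V_ℓ` (width `t`): `rank(D N(p) D') ≤ t`, `rank coeff(D N D') ≤ t·#V_{ℓ+1}`, giving (H) with `≤ 10·m·t`.

Mechanism (✓ `…CutAlgebra`): the cycle `K N_s K N_t K E` leaves `U` once (through `E`) and re-enters once, through the
connecting block `D N(p) D'` hidden in an off-diagonal block `D K D' = DKD·DN(p)D'·D'KD'` of `K` or through a connecting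
direction `D N_s D'` / `D N_t D'`; the five resulting bilinear forms (`cut_five_terms`) have rank `≤ m·rank(DN(p)D')`
(three of them, two-family trace lemma) or `≤ rank coeff(DND')` (two of them).

HONEST FRAMING: (H) on a CLASS (pencils with one thin invariant cut and an off-diagonal numerator); the wild case without
invariant subspaces is untouched; closes no stub — `stub_dualUnipotent`, 24318, `stub_longMassSlowLawInv`, `VP ≠ VNP`
untouched.  No definitions, no named facts, no sorry.
-/

noncomputable section

-- single-conjunct layout `Summits/ValiantsHypothesis/ValiantsHypothesis`: the duplicated namespace component is mandated
set_option linter.dupNamespace false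

namespace Summit.ValiantsHypothesis.ValiantsHypothesis.Theorems.GrenetZeon.CutLemma

open MvPolynomial Matrix
open Literature.Computability.AlgebraicComplexity
open Summit.ValiantsHypothesis.ValiantsHypothesis.Theorems.GrenetZeon.ThinNumerator
open Summit.ValiantsHypothesis.ValiantsHypothesis.Theorems.GrenetZeon.CentredNumerator
open Summit.ValiantsHypothesis.ValiantsHypothesis.Cruxes.TwoDimCoefficients.DimTwoCases (AffMat IsAffine)

/-! ### §1 The five-term expansion in a ring -/

section Ring

variable {R : Type*} [Ring R]

/-- Splitting a product at the cut: `D·(K·Y)·D' = DKD·(DYD') + DKD'·(D'YD')`. [folklore] -/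
theorem cut_split {D D' : R} (h1 : D + D' = 1) (hD : D * D = D) (hD' : D' * D' = D') (K Y : R) :
    D * (K * Y) * D' = D * K * D * (D * Y * D') + D * K * D' * (D' * Y * D') := by
  have e : D * (K * Y) * D' = D * (K * ((D + D') * Y)) * D' := by rw [h1, one_mul]
  have e2 : D * (K * ((D + D') * Y)) * D' = D * K * (D * D) * Y * D' + D * K * (D' * D') * Y * D' := by
    rw [hD, hD']; noncomm_ring
  have e3 : D * K * D * (D * Y * D') + D * K * D' * (D' * Y * D') =
      D * K * (D * D) * Y * D' + D * K * (D' * D') * Y * D' := by noncomm_ring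
  rw [e, e2, ← e3]

/-- ★ **Five terms.**  With an idempotent splitting `D + D' = 1`, a block-upper `P` with two-sided inverse `K` of `1 − P`,
and block-upper directions `X`, `Y`:
`D·(K X K Y K)·D' = T₁ + T₂ₐ + T₂ᵦ + T₄ₐ + T₄ᵦ`, each term containing the connecting block `DPD'` or a connecting
direction `DXD'`, `DYD'`. [folklore] -/
theorem cut_five_terms {D D' K P X Y : R} (h1 : D + D' = 1) (hDD' : D * D' = 0) (hD'D : D' * D = 0)
    (hD : D * D = D) (hD' : D' * D' = D') (hP : D' * P * D = 0) (hK1 : K * (1 - P) = 1) (hK2 : (1 - P) * K = 1)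
    (hK : D' * K * D = 0) (hY : D' * Y * D = 0) :
    D * (K * X * K * Y * K) * D' =
      D * K * X * D * (D * K * Y * D) * (D * K * D * (D * P * D') * (D' * K * D') ) +
      D * K * X * D * (D * K * D * (D * Y * D')) * (D' * K * D') +
      D * K * X * D * (D * K * D * (D * P * D') * (D' * K * D') * (D' * Y * D')) * (D' * K * D') +
      D * K * D * (D * X * D') * (D' * (K * Y) * D') * (D' * K * D') +
      D * K * D * (D * P * D') * (D' * K * D') * (D' * X * D') * (D' * (K * Y) * D') * (D' * K * D') := by
  have hKY : D' * (K * Y) * D = 0 := cut_mul h1 hK hY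
  have e1 := cut_expand3 (X := K * X) (Y := K * Y) (Z := K) h1 hD hD' hKY
  have eS := cut_resolvent_split h1 hDD' hD'D hD hD' hP hK1 hK2
  have eY := cut_split h1 hD hD' K Y
  have eX := cut_split h1 hD hD' K X
  rw [show K * X * K * Y * K = K * X * (K * Y) * K by noncomm_ring, e1, eY, eX, eS]
  noncomm_ring

end Ring

/-! ### §2 Entry forms of the five terms (reassociation / cyclicity) -/

section Entry

variable {m : ℕ}

/-- `T₁`: `tr(DKXD·DKYD·(DKD·DPD'·D'KD')·E) = tr((DKXD)·(DKYD)·F₁)`. [folklore] -/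
theorem entry_T1 (D D' K P X Y E : Matrix (Fin m) (Fin m) ℂ) :
    (D * K * X * D * (D * K * Y * D) * (D * K * D * (D * P * D') * (D' * K * D')) * E).trace =
      ((D * K * X * D) * (D * K * Y * D) * (D * K * D * (D * P * D') * (D' * K * D') * E)).trace := by
  simp only [Matrix.mul_assoc]

/-- `T₂ₐ`: `tr(DKXD·(DKD·DYD')·D'KD'·E) = tr((D'KD'·E·DKXD·DKD)·1·(DYD'))`. [folklore] -/
theorem entry_T2a (D D' K X Y E : Matrix (Fin m) (Fin m) ℂ) :
    (D * K * X * D * (D * K * D * (D * Y * D')) * (D' * K * D') * E).trace =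
      ((D' * K * D' * E * (D * K * X * D) * (D * K * D)) * 1 * (D * Y * D')).trace := by
  rw [Matrix.mul_one, show D * K * X * D * (D * K * D * (D * Y * D')) * (D' * K * D') * E =
      (D * K * X * D * (D * K * D)) * (D * Y * D') * (D' * K * D' * E) by simp only [Matrix.mul_assoc],
    Matrix.trace_mul_cycle]
  simp only [Matrix.mul_assoc]

/-- `T₂ᵦ`: `tr(DKXD·(DKD·DPD'·D'KD'·D'YD')·D'KD'·E) = tr((D'KD'·D'YD'·D'KD'·E)·(DKXD·DKD)·(DPD'))`. [folklore] -/
theorem entry_T2b (D D' K P X Y E : Matrix (Fin m) (Fin m) ℂ) :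
    (D * K * X * D * (D * K * D * (D * P * D') * (D' * K * D') * (D' * Y * D')) * (D' * K * D') * E).trace =
      ((D' * K * D' * (D' * Y * D') * (D' * K * D') * E) * (D * K * X * D * (D * K * D)) * (D * P * D')).trace := by
  rw [show D * K * X * D * (D * K * D * (D * P * D') * (D' * K * D') * (D' * Y * D')) * (D' * K * D') * E =
      (D * K * X * D * (D * K * D)) * (D * P * D') * (D' * K * D' * (D' * Y * D') * (D' * K * D') * E) by
        simp only [Matrix.mul_assoc],
    Matrix.trace_mul_cycle]

/-- `T₄ₐ`: `tr((DKD·DXD')·D'(KY)D'·D'KD'·E) = tr((D'(KY)D'·D'KD'·E·DKD)·1·(DXD'))`. [folklore] -/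
theorem entry_T4a (D D' K X Y E : Matrix (Fin m) (Fin m) ℂ) :
    (D * K * D * (D * X * D') * (D' * (K * Y) * D') * (D' * K * D') * E).trace =
      ((D' * (K * Y) * D' * (D' * K * D') * E * (D * K * D)) * 1 * (D * X * D')).trace := by
  rw [Matrix.mul_one, show D * K * D * (D * X * D') * (D' * (K * Y) * D') * (D' * K * D') * E =
      (D * K * D) * (D * X * D') * (D' * (K * Y) * D' * (D' * K * D') * E) by simp only [Matrix.mul_assoc],
    Matrix.trace_mul_cycle]

/-- `T₄ᵦ`: `tr((DKD·DPD'·D'KD'·D'XD')·D'(KY)D'·D'KD'·E) = tr((D'KD'·D'XD')·(D'(KY)D'·D'KD'·E·DKD)·(DPD'))`.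
[folklore] -/
theorem entry_T4b (D D' K P X Y E : Matrix (Fin m) (Fin m) ℂ) :
    (D * K * D * (D * P * D') * (D' * K * D') * (D' * X * D') * (D' * (K * Y) * D') * (D' * K * D') * E).trace =
      ((D' * K * D' * (D' * X * D')) * (D' * (K * Y) * D' * (D' * K * D') * E * (D * K * D)) * (D * P * D')).trace := by
  rw [show D * K * D * (D * P * D') * (D' * K * D') * (D' * X * D') * (D' * (K * Y) * D') * (D' * K * D') * E =
      (D * K * D) * (D * P * D') * (D' * K * D' * (D' * X * D') * (D' * (K * Y) * D' * (D' * K * D') * E)) by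
        simp only [Matrix.mul_assoc],
    Matrix.trace_mul_cycle]
  simp only [Matrix.mul_assoc]

end Entry

/-! ### §3 The one-cut Hessian-rate lemma -/

section Cut

variable {n m : ℕ}

/-- ★★★ **One-cut bound for the centred cross form.**  See the module docstring. [folklore] -/
theorem rank_cross_const_le_of_cut (N : AffMat n m) (E D : Matrix (Fin m) (Fin m) ℂ) (hnil : N ^ m = 0)
    (hD : D * D = D)
    (hcutc : ∀ t : Fin n × Fin n, (1 - D) * N.map (coeff (Finsupp.single t 1)) * D = 0)
    (p : Fin n × Fin n → ℂ) (hcutp : (1 - D) * N.map (eval p) * D = 0)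
    (hE : D * E * D = 0) (hE' : (1 - D) * E * (1 - D) = 0) :
    (Matrix.of fun s t : Fin n × Fin n =>
        ((∑ j ∈ Finset.range m, N.map (eval p) ^ j) * N.map (coeff (Finsupp.single s 1)) *
          (∑ j ∈ Finset.range m, N.map (eval p) ^ j) *
          (N.map (coeff (Finsupp.single t 1)) * ((∑ j ∈ Finset.range m, N.map (eval p) ^ j) * E))).trace).rank ≤
      3 * (m * (D * N.map (eval p) * (1 - D)).rank) +
        2 * (Matrix.of fun (lk : Fin m × Fin m) (t : Fin n × Fin n) =>
          coeff (Finsupp.single t 1)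
            ((D.map (C : ℂ → MvPolynomial (Fin n × Fin n) ℂ) * N *
              (1 - D).map (C : ℂ → MvPolynomial (Fin n × Fin n) ℂ)) lk.1 lk.2)).rank := by
  set K : Matrix (Fin m) (Fin m) ℂ := ∑ j ∈ Finset.range m, N.map (eval p) ^ j with hK
  set P : Matrix (Fin m) (Fin m) ℂ := N.map (eval p) with hP
  set D' : Matrix (Fin m) (Fin m) ℂ := 1 - D with hD'def
  set Nc : Fin n × Fin n → Matrix (Fin m) (Fin m) ℂ := fun s => N.map (coeff (Finsupp.single s 1)) with hNc
  -- idempotent bookkeeping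
  have h1 : D + D' = 1 := by rw [hD'def, add_sub_cancel]
  have hDD' : D * D' = 0 := by rw [hD'def, Matrix.mul_sub, Matrix.mul_one, hD, sub_self]
  have hD'D : D' * D = 0 := by rw [hD'def, Matrix.sub_mul, Matrix.one_mul, hD, sub_self]
  have hD'2 : D' * D' = D' := by
    rw [hD'def, Matrix.sub_mul, Matrix.one_mul, Matrix.mul_sub, Matrix.mul_one, hD, sub_self, sub_zero]
  -- the resolvent `K` is the two-sided inverse of `1 − P`, and block-upper
  have hPm : P ^ m = 0 := map_eval_pow_eq_zero N hnil p
  have hK1 : K * (1 - P) = 1 := by rw [hK, geom_sum_mul_neg, hPm, sub_zero]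
  have hK2 : (1 - P) * K = 1 := by rw [hK, mul_neg_geom_sum, hPm, sub_zero]
  have hPcut : D' * P * D = 0 := hcutp
  have hKcut : D' * K * D = 0 :=
    cut_sum (Finset.range m) _ fun j _ => cut_pow h1 hD'D hPcut j
  -- the block-upper product `Q = K N_s K N_t K`
  have hQ : ∀ s t, D' * (K * Nc s * K * Nc t * K) * D = 0 := fun s t =>
    cut_mul h1 (cut_mul h1 (cut_mul h1 (cut_mul h1 hKcut (hcutc s)) hKcut) (hcutc t)) hKcut
  -- entrywise five-term expansion
  have hentry : ∀ s t : Fin n × Fin n,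
      (K * Nc s * K * (Nc t * (K * E))).trace =
        ((D * K * Nc s * D) * (D * K * Nc t * D) * (D * K * D * (D * P * D') * (D' * K * D') * E)).trace +
        ((D' * K * D' * E * (D * K * Nc s * D) * (D * K * D)) * 1 * (D * Nc t * D')).trace +
        ((D' * K * D' * (D' * Nc t * D') * (D' * K * D') * E) * (D * K * Nc s * D * (D * K * D)) *
          (D * P * D')).trace +
        ((D' * (K * Nc t) * D' * (D' * K * D') * E * (D * K * D)) * 1 * (D * Nc s * D')).trace +
        ((D' * K * D' * (D' * Nc s * D')) * (D' * (K * Nc t) * D' * (D' * K * D') * E * (D * K * D)) *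
          (D * P * D')).trace := by
    intro s t
    rw [show K * Nc s * K * (Nc t * (K * E)) = (K * Nc s * K * Nc t * K) * E by simp only [Matrix.mul_assoc],
      trace_mul_eq_trace_cut h1 (hQ s t) hE hE',
      cut_five_terms h1 hDD' hD'D hD hD'2 hPcut hK1 hK2 hKcut (hcutc t)]
    simp only [Matrix.add_mul, Matrix.trace_add]
    rw [entry_T1, entry_T2a, entry_T2b, entry_T4a, entry_T4b]
  -- the five matrices
  set M1 : Matrix (Fin n × Fin n) (Fin n × Fin n) ℂ := Matrix.of fun s t =>
    ((D * K * Nc s * D) * (D * K * Nc t * D) * (D * K * D * (D * P * D') * (D' * K * D') * E)).trace with hM1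
  set M2a : Matrix (Fin n × Fin n) (Fin n × Fin n) ℂ := Matrix.of fun s t =>
    ((D' * K * D' * E * (D * K * Nc s * D) * (D * K * D)) * 1 * (D * Nc t * D')).trace with hM2a
  set M2b : Matrix (Fin n × Fin n) (Fin n × Fin n) ℂ := Matrix.of fun s t =>
    ((D' * K * D' * (D' * Nc t * D') * (D' * K * D') * E) * (D * K * Nc s * D * (D * K * D)) *
      (D * P * D')).trace with hM2b
  set M4a : Matrix (Fin n × Fin n) (Fin n × Fin n) ℂ := Matrix.of fun s t =>
    ((D' * (K * Nc t) * D' * (D' * K * D') * E * (D * K * D)) * 1 * (D * Nc s * D')).trace with hM4a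
  set M4b : Matrix (Fin n × Fin n) (Fin n × Fin n) ℂ := Matrix.of fun s t =>
    ((D' * K * D' * (D' * Nc s * D')) * (D' * (K * Nc t) * D' * (D' * K * D') * E * (D * K * D)) *
      (D * P * D')).trace with hM4b
  have hsum : (Matrix.of fun s t : Fin n × Fin n => (K * Nc s * K * (Nc t * (K * E))).trace) =
      M1 + M2a + M2b + M4a + M4b := by
    refine Matrix.ext fun s t => ?_
    simp only [hM1, hM2a, hM2b, hM4a, hM4b, Matrix.add_apply, Matrix.of_apply]
    exact hentry s t
  -- the connecting block is the coefficient of the affine matrix `D·N·D'`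
  have hcoeff : ∀ t : Fin n × Fin n,
      (D.map (C : ℂ → MvPolynomial (Fin n × Fin n) ℂ) * N *
        (1 - D).map (C : ℂ → MvPolynomial (Fin n × Fin n) ℂ)).map (coeff (Finsupp.single t 1)) = D * Nc t * D' := by
    intro t
    rw [map_coeff_mul_map_C, map_coeff_map_C_mul]
  -- rank of the connecting-block factors
  have hrb1 : (D * K * D * (D * P * D') * (D' * K * D') * E).rank ≤ (D * P * D').rank :=
    (Matrix.rank_mul_le_left _ _).trans ((Matrix.rank_mul_le_left _ _).trans (Matrix.rank_mul_le_right _ _))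
  have hrb2 : (D * P * D').rank ≤ (D * P * D').rank := le_rfl
  -- the five bounds
  have b1 : M1.rank ≤ m * (D * P * D').rank :=
    (rank_of_trace_mul_mul_le₂ (fun s => D * K * Nc s * D) (fun t => D * K * Nc t * D) _).trans
      (Nat.mul_le_mul_left m hrb1)
  have b2a : M2a.rank ≤ (Matrix.of fun (lk : Fin m × Fin m) (t : Fin n × Fin n) =>
      coeff (Finsupp.single t 1) ((D.map (C : ℂ → MvPolynomial (Fin n × Fin n) ℂ) * N *
        (1 - D).map (C : ℂ → MvPolynomial (Fin n × Fin n) ℂ)) lk.1 lk.2)).rank := by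
    have h := rank_of_trace_mul_mul_coeff_le (fun s => D' * K * D' * E * (D * K * Nc s * D) * (D * K * D)) 1
      (D.map (C : ℂ → MvPolynomial (Fin n × Fin n) ℂ) * N * (1 - D).map (C : ℂ → MvPolynomial (Fin n × Fin n) ℂ))
    have e : (Matrix.of fun s t : Fin n × Fin n => (D' * K * D' * E * (D * K * Nc s * D) * (D * K * D) * 1 *
        (D.map (C : ℂ → MvPolynomial (Fin n × Fin n) ℂ) * N *
          (1 - D).map (C : ℂ → MvPolynomial (Fin n × Fin n) ℂ)).map (coeff (Finsupp.single t 1))).trace) = M2a := by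
      refine Matrix.ext fun s t => ?_
      rw [Matrix.of_apply, hM2a, Matrix.of_apply, hcoeff t]
    rw [e] at h
    exact h
  have b2b : M2b.rank ≤ m * (D * P * D').rank := by
    have h := rank_of_trace_mul_mul_le₂ (fun t => D' * K * D' * (D' * Nc t * D') * (D' * K * D') * E)
      (fun s => D * K * Nc s * D * (D * K * D)) (D * P * D')
    have e : (Matrix.of fun t s : Fin n × Fin n => (D' * K * D' * (D' * Nc t * D') * (D' * K * D') * E *
        (D * K * Nc s * D * (D * K * D)) * (D * P * D')).trace) = M2bᵀ := by
      refine Matrix.ext fun t s => ?_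
      rw [Matrix.of_apply, Matrix.transpose_apply, hM2b, Matrix.of_apply]
    rw [e, Matrix.rank_transpose] at h
    exact h
  have b4a : M4a.rank ≤ (Matrix.of fun (lk : Fin m × Fin m) (t : Fin n × Fin n) =>
      coeff (Finsupp.single t 1) ((D.map (C : ℂ → MvPolynomial (Fin n × Fin n) ℂ) * N *
        (1 - D).map (C : ℂ → MvPolynomial (Fin n × Fin n) ℂ)) lk.1 lk.2)).rank := by
    have h := rank_of_trace_mul_mul_coeff_le (fun t => D' * (K * Nc t) * D' * (D' * K * D') * E * (D * K * D)) 1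
      (D.map (C : ℂ → MvPolynomial (Fin n × Fin n) ℂ) * N * (1 - D).map (C : ℂ → MvPolynomial (Fin n × Fin n) ℂ))
    have e : (Matrix.of fun t s : Fin n × Fin n => (D' * (K * Nc t) * D' * (D' * K * D') * E * (D * K * D) * 1 *
        (D.map (C : ℂ → MvPolynomial (Fin n × Fin n) ℂ) * N *
          (1 - D).map (C : ℂ → MvPolynomial (Fin n × Fin n) ℂ)).map (coeff (Finsupp.single s 1))).trace) = M4aᵀ := by
      refine Matrix.ext fun t s => ?_
      rw [Matrix.of_apply, Matrix.transpose_apply, hM4a, Matrix.of_apply, hcoeff s]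
    rw [e, Matrix.rank_transpose] at h
    exact h
  have b4b : M4b.rank ≤ m * (D * P * D').rank :=
    rank_of_trace_mul_mul_le₂ (fun s => D' * K * D' * (D' * Nc s * D'))
      (fun t => D' * (K * Nc t) * D' * (D' * K * D') * E * (D * K * D)) (D * P * D')
  -- assemble
  have eNc : (Matrix.of fun s t : Fin n × Fin n =>
      ((∑ j ∈ Finset.range m, N.map (eval p) ^ j) * N.map (coeff (Finsupp.single s 1)) *
        (∑ j ∈ Finset.range m, N.map (eval p) ^ j) *
        (N.map (coeff (Finsupp.single t 1)) * ((∑ j ∈ Finset.range m, N.map (eval p) ^ j) * E))).trace) =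
      Matrix.of fun s t : Fin n × Fin n => (K * Nc s * K * (Nc t * (K * E))).trace := rfl
  rw [eNc, hsum, hD'def] at *
  calc (M1 + M2a + M2b + M4a + M4b).rank
      ≤ M1.rank + M2a.rank + M2b.rank + M4a.rank + M4b.rank :=
        (rank_add_le' _ _).trans (Nat.add_le_add_right ((rank_add_le' _ _).trans (Nat.add_le_add_right
          ((rank_add_le' _ _).trans (Nat.add_le_add_right (rank_add_le' _ _) _)) _)) _)
    _ ≤ _ := by omega

/-- ★★★ **One-cut Hessian-rate lemma.**  Under the hypotheses of `rank_cross_const_le_of_cut`: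
`rank Hess_p (Σ_{j<m} tr(N^j·E)) ≤ 6·m·rank(D·N(p)·(1 − D)) + 4·rank coeff(D·N·(1 − D))`. [folklore] -/
theorem rank_hess0_resolvent_const_le_of_cut (N : AffMat n m) (hN : IsAffine N) (E D : Matrix (Fin m) (Fin m) ℂ)
    (hnil : N ^ m = 0) (hD : D * D = D)
    (hcutc : ∀ t : Fin n × Fin n, (1 - D) * N.map (coeff (Finsupp.single t 1)) * D = 0)
    (p : Fin n × Fin n → ℂ) (hcutp : (1 - D) * N.map (eval p) * D = 0)
    (hE : D * E * D = 0) (hE' : (1 - D) * E * (1 - D) = 0) :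
    (hess0 (transl p (∑ j ∈ Finset.range m, (N ^ j * E.map C).trace))).rank ≤
      6 * (m * (D * N.map (eval p) * (1 - D)).rank) +
        4 * (Matrix.of fun (lk : Fin m × Fin m) (t : Fin n × Fin n) =>
          coeff (Finsupp.single t 1)
            ((D.map (C : ℂ → MvPolynomial (Fin n × Fin n) ℂ) * N *
              (1 - D).map (C : ℂ → MvPolynomial (Fin n × Fin n) ℂ)) lk.1 lk.2)).rank := by
  have h := rank_hess0_resolvent_const_le_two_rank_cross N hN E hnil p
  have h2 := rank_cross_const_le_of_cut N E D hnil hD hcutc p hcutp hE hE'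
  omega

end Cut

/-! ### §4 Coordinate cuts -/

section Coord

variable {n m : ℕ}

/-- Entries of `diag(a)·X·diag(b)`. [folklore] -/
theorem diagonal_mul_mul_diagonal_apply (a b : Fin m → ℂ) (X : Matrix (Fin m) (Fin m) ℂ) (i j : Fin m) :
    (Matrix.diagonal a * X * Matrix.diagonal b) i j = a i * X i j * b j := by
  rw [Matrix.mul_diagonal, Matrix.diagonal_mul]

/-- ★★★ **One-cut lemma, coordinate form.**  Let `S` be a set of coordinates such that the pencil maps
`U = ⟨e_j : j ∈ S⟩` into itself (`N i j = 0` for `i ∉ S`, `j ∈ S`) and the constant numerator `E` has no diagonal blocks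
(`E i j = 0` whenever `i ∈ S ↔ j ∈ S`).  Then at every point `p`
`rank Hess_p Σ_{j<m} tr(N^j·E) ≤ 6·m·rank[N(p)]_{S × Sᶜ} + 4·rank coeff[N]_{S × Sᶜ}`:
only the connecting block `S × Sᶜ` of the pencil enters. [folklore] -/
theorem rank_hess0_resolvent_const_le_of_coordCut (N : AffMat n m) (hN : IsAffine N)
    (E : Matrix (Fin m) (Fin m) ℂ) (hnil : N ^ m = 0) (S : Finset (Fin m))
    (hcut : ∀ i j, i ∉ S → j ∈ S → N i j = 0) (hE : ∀ i j, (i ∈ S ↔ j ∈ S) → E i j = 0)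
    (p : Fin n × Fin n → ℂ) :
    (hess0 (transl p (∑ j ∈ Finset.range m, (N ^ j * E.map C).trace))).rank ≤
      6 * (m * (Matrix.of fun i j : Fin m => if i ∈ S ∧ j ∉ S then eval p (N i j) else 0).rank) +
        4 * (Matrix.of fun (lk : Fin m × Fin m) (t : Fin n × Fin n) =>
          if lk.1 ∈ S ∧ lk.2 ∉ S then coeff (Finsupp.single t 1) (N lk.1 lk.2) else 0).rank := by
  classical
  set d : Fin m → ℂ := fun i => if i ∈ S then 1 else 0 with hd
  set D : Matrix (Fin m) (Fin m) ℂ := Matrix.diagonal d with hDdef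
  have hd2 : ∀ i, d i * d i = d i := fun i => by simp only [hd]; split_ifs <;> simp
  have hD : D * D = D := by
    rw [hDdef, Matrix.diagonal_mul_diagonal]
    exact congrArg Matrix.diagonal (funext hd2)
  have hD' : (1 : Matrix (Fin m) (Fin m) ℂ) - D = Matrix.diagonal fun i => 1 - d i := by
    rw [hDdef, ← Matrix.diagonal_one, ← Matrix.diagonal_sub]
  -- the cut hypotheses in matrix form
  have hcutX : ∀ X : Matrix (Fin m) (Fin m) ℂ, (∀ i j, i ∉ S → j ∈ S → X i j = 0) → (1 - D) * X * D = 0 := by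
    intro X hX
    ext i j
    rw [hD', hDdef, diagonal_mul_mul_diagonal_apply, Matrix.zero_apply, hd]
    by_cases hi : i ∈ S
    · simp [hi]
    · by_cases hj : j ∈ S
      · rw [hX i j hi hj, mul_zero, zero_mul]
      · simp [hj]
  have hcutc : ∀ t : Fin n × Fin n, (1 - D) * N.map (coeff (Finsupp.single t 1)) * D = 0 := fun t =>
    hcutX _ fun i j hi hj => by rw [Matrix.map_apply, hcut i j hi hj, coeff_zero]
  have hcutp : (1 - D) * N.map (eval p) * D = 0 :=
    hcutX _ fun i j hi hj => by rw [Matrix.map_apply, hcut i j hi hj, map_zero]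
  have hE1 : D * E * D = 0 := by
    ext i j
    rw [hDdef, diagonal_mul_mul_diagonal_apply, Matrix.zero_apply, hd]
    by_cases hi : i ∈ S
    · by_cases hj : j ∈ S
      · rw [hE i j (iff_of_true hi hj), mul_zero, zero_mul]
      · simp [hj]
    · simp [hi]
  have hE2 : (1 - D) * E * (1 - D) = 0 := by
    ext i j
    rw [hD', diagonal_mul_mul_diagonal_apply, Matrix.zero_apply, hd]
    by_cases hi : i ∈ S
    · simp [hi]
    · by_cases hj : j ∈ S
      · simp [hj]
      · rw [hE i j (iff_of_false hi hj), mul_zero, zero_mul]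
  have h := rank_hess0_resolvent_const_le_of_cut N hN E D hnil hD hcutc p hcutp hE1 hE2
  -- identify the two connecting blocks
  have e1 : D * N.map (eval p) * (1 - D) = Matrix.of fun i j : Fin m => if i ∈ S ∧ j ∉ S then eval p (N i j) else 0 := by
    ext i j
    rw [hD', hDdef, diagonal_mul_mul_diagonal_apply, Matrix.of_apply, Matrix.map_apply, hd]
    by_cases hi : i ∈ S <;> by_cases hj : j ∈ S <;> simp [hi, hj]
  have e2 : (Matrix.of fun (lk : Fin m × Fin m) (t : Fin n × Fin n) =>
        coeff (Finsupp.single t 1) ((D.map (C : ℂ → MvPolynomial (Fin n × Fin n) ℂ) * N *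
          (1 - D).map (C : ℂ → MvPolynomial (Fin n × Fin n) ℂ)) lk.1 lk.2)) =
      Matrix.of fun (lk : Fin m × Fin m) (t : Fin n × Fin n) =>
        if lk.1 ∈ S ∧ lk.2 ∉ S then coeff (Finsupp.single t 1) (N lk.1 lk.2) else 0 := by
    refine Matrix.ext fun lk t => ?_
    have hc := congr_fun (congr_fun (map_coeff_mul_map_C (D.map C * N) (1 - D) (Finsupp.single t 1)) lk.1) lk.2
    rw [Matrix.map_apply, map_coeff_map_C_mul] at hc
    rw [Matrix.of_apply, Matrix.of_apply, hc, hD', hDdef, diagonal_mul_mul_diagonal_apply, Matrix.map_apply, hd]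
    by_cases hi : lk.1 ∈ S <;> by_cases hj : lk.2 ∈ S <;> simp [hi, hj]
  rw [e1, e2] at h
  exact h

end Coord

end Summit.ValiantsHypothesis.ValiantsHypothesis.Theorems.GrenetZeon.CutLemma

end
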